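import Literature.Probability.Percolation.AnnulusFourArmOrder
import Literature.Probability.Percolation.AdjFourArmCyclic
import HarnessLib

/-!
# Four disjoint crossing paths keep the separation pattern of their ends

Topic `Literature/Probability/Percolation`; family `crit-perc` (planar combinatorics of site
percolation on `𝕋`). A brick of the near-critical arm-separation theorem for four arms in the
ADJACENT colour arrangement (P. Nolin, EJP 13 (2008), Thm. 11, `j = 4`, `σ = BBWW`
[arXiv 0711.4948: Thm. 10], §4.4): the outer landing must route the four exits in the cyclic order
of the arms, and this order certificate is read off the ends of four pairwise disjoint crossing
paths of the annulus `{n ≤ |v| ≤ N}` by the order transfer of `AnnulusOrderTransfer.lean`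
(`IsSlit.hexShift_lt_iff`, Bollobás–Riordan's "but not both"):

* `hexSep_iff_xor_shift` — for four points of `∂Λ_N`, `{a, b}` separates `{c, d}` iff, read
  anticlockwise from `c`, exactly one of `a`, `b` comes before `d`;
* **`hexSep_iff_of_four_paths`** — four pairwise disjoint sets of the annulus, each carrying a path
  from `∂Λ_n` to `∂Λ_N` meeting the two circles only at its ends: the ends of the paths `1, 3`
  separate those of the paths `0, 2` on the outer circle iff they do on the inner circle.

Everything here is proved; no named facts are introduced.

## References

* B. Bollobás, O. Riordan, *Percolation*, CUP (2006), Ch. 7 §7.2.2, Lemma 5 p. 169 [BollobasRiordan2006].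
* P. Nolin, Near-critical percolation in two dimensions, EJP 13 (2008), §4.1, §4.4 (arXiv 0711.4948: Def. 7; proof of Thm. 10) [Nolin2008].
-/

noncomputable section

namespace Literature.Probability.Percolation

open LatticeModels

/-- **Separation read from one of the four points**: `{a, b}` separates `{c, d}` iff exactly one of
`a`, `b` comes before `d` anticlockwise from `c`. [folklore] -/
theorem hexSep_iff_xor_shift {N : ℕ} (hN : 1 ≤ N) {a b c d : Site 2} (ha : triNorm a = N) (hb : triNorm b = N)
    (hc : triNorm c = N) (hd : triNorm d = N) (hac : a ≠ c) (hbc : b ≠ c) (had : a ≠ d) (hbd : b ≠ d) (hcd : c ≠ d) :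
    HexSep (hexPos N a) (hexPos N b) (hexPos N c) (hexPos N d) ↔
      ((hexShift N c a < hexShift N c d ∧ ¬ hexShift N c b < hexShift N c d) ∨
        (hexShift N c b < hexShift N c d ∧ ¬ hexShift N c a < hexShift N c d)) := by
  have ra := hexPos_range hN ha; have rb := hexPos_range hN hb; have rc := hexPos_range hN hc; have rd := hexPos_range hN hd
  have nac : hexPos N a ≠ hexPos N c := fun e => hac (hexPos_injOn hN ha hc e)
  have nbc : hexPos N b ≠ hexPos N c := fun e => hbc (hexPos_injOn hN hb hc e)
  have nad : hexPos N a ≠ hexPos N d := fun e => had (hexPos_injOn hN ha hd e)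
  have nbd : hexPos N b ≠ hexPos N d := fun e => hbd (hexPos_injOn hN hb hd e)
  have ncd : hexPos N c ≠ hexPos N d := fun e => hcd (hexPos_injOn hN hc hd e)
  unfold HexSep HexBtw hexShift
  split_ifs <;> omega

/-- **Four disjoint crossing paths keep the separation pattern of their ends.** Pairwise disjoint
sets `W j ⊆ {n ≤ |v| ≤ N}` (`1 ≤ n`, `n + 2 ≤ N`), each with a path from `x j ∈ ∂Λ_n` to
`y j ∈ ∂Λ_N` and no other site on the two circles: `{y 1, y 3}` separates `{y 0, y 2}` on `∂Λ_N` iff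
`{x 1, x 3}` separates `{x 0, x 2}` on `∂Λ_n`. [cite: BollobasRiordan2006, Ch. 7 Lemma 5 p. 169] -/
theorem hexSep_iff_of_four_paths {n N : ℕ} (hn : 1 ≤ n) (hnN : n + 2 ≤ N) {x y : Fin 4 → Site 2} {W : Fin 4 → Set (Site 2)}
    (hW : ∀ j, W j ⊆ triAnn n N) (hx : ∀ j, triNorm (x j) = n) (hy : ∀ j, triNorm (y j) = N)
    (hP : ∀ j, PathIn triGraph (W j) (x j) (y j))
    (hin : ∀ j, ∀ v ∈ W j, triNorm v = n → v = x j) (hout : ∀ j, ∀ v ∈ W j, triNorm v = N → v = y j)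
    (hdisj : Pairwise fun i j => Disjoint (W i) (W j)) :
    HexSep (hexPos N (y 1)) (hexPos N (y 3)) (hexPos N (y 0)) (hexPos N (y 2)) ↔
      HexSep (hexPos n (x 1)) (hexPos n (x 3)) (hexPos n (x 0)) (hexPos n (x 2)) := by
  have hN : 1 ≤ N := by omega
  -- a slit inside the path `0`
  obtain ⟨S, s, t, hS, hSsub⟩ := exists_isSlit hn hnN (hW 0) (hx 0) (hy 0) (hP 0)
  have hSW : S ⊆ W 0 := fun v hv => (hSsub hv).left_mem
  have hs : s = x 0 := by
    obtain ⟨v, hv⟩ : S.Nonempty := ⟨t, hS.mem_t⟩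
    have := (hS.conn v hv).left_mem
    exact hin 0 s (hSW this) hS.norm_s
  have ht : t = y 0 := hout 0 t (hSW hS.mem_t) hS.norm_t
  subst hs ht
  -- distinct ends
  have hxne : ∀ {i j : Fin 4}, i ≠ j → x i ≠ x j := fun {i j} hij e =>
    Set.disjoint_left.1 (hdisj hij) (hP i).left_mem (e ▸ (hP j).left_mem)
  have hyne : ∀ {i j : Fin 4}, i ≠ j → y i ≠ y j := fun {i j} hij e =>
    Set.disjoint_left.1 (hdisj hij) (hP i).right_mem (e ▸ (hP j).right_mem)
  -- the order transfer for the pairs `(1, 2)` and `(3, 2)` read from the path `0`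
  have htr : ∀ {i j : Fin 4}, i ≠ 0 → j ≠ 0 → i ≠ j →
      (hexShift n (x 0) (x i) < hexShift n (x 0) (x j) ↔ hexShift N (y 0) (y i) < hexShift N (y 0) (y j)) := by
    intro i j hi0 hj0 hij
    have hXi : W i ⊆ triAnn n N \ S := fun v hv => ⟨hW i hv, fun hvS => Set.disjoint_left.1 (hdisj hi0) hv (hSW hvS)⟩
    refine hS.hexShift_lt_iff hXi (hP i) ((hP j).mono fun v hv => ⟨⟨hW j hv, fun hvS => ?_⟩, fun hvi => ?_⟩) (hx i) (hy i) (hx j) (hy j)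
    · exact Set.disjoint_left.1 (hdisj hj0) hv (hSW hvS)
    · exact Set.disjoint_left.1 (hdisj hij) hvi hv
  have h12 := htr (i := 1) (j := 2) (by decide) (by decide) (by decide)
  have h32 := htr (i := 3) (j := 2) (by decide) (by decide) (by decide)
  rw [hexSep_iff_xor_shift hN (hy 1) (hy 3) (hy 0) (hy 2) (hyne (by decide)) (hyne (by decide)) (hyne (by decide)) (hyne (by decide))
      (hyne (by decide)),
    hexSep_iff_xor_shift hn (hx 1) (hx 3) (hx 0) (hx 2) (hxne (by decide)) (hxne (by decide)) (hxne (by decide)) (hxne (by decide))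
      (hxne (by decide)), h12, h32]

end Literature.Probability.Percolation
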